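import Summits.Ventures.PercRepro.RLSRuleTriangleTypes
import Summits.Ventures.PercRepro.RLSRuleKFourTypes
import Summits.Ventures.PercRepro.RLSRuleTwoLinesSix
import Summits.Ventures.PercRepro.RLSRuleCoreSix

/-!
# C-025 at q = 3: the `6`-point planes of the core are two lines, the triangle or `K₄` — and the lane closes
(night-3, gen 4)

On the core every plane has `≤ 6` points (`card_le_six_of_core`) and in a `6`-point plane every point is avoided by a
`3`-point line (`exists_line_avoiding_of_six`).  Two `3`-point lines of a simple plane without `4`-point lines meet in
at most one point, so every point lies on at most two lines (`deg_le_two_of_lines`) and there are at most four lines;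
the points on two lines are pairwise meeting points (`card_deg_two_le`).  Hence the line set is: two lines
(`TwoLinesAny`), three lines with degrees `2, 2, 2, 1, 1, 1` (`Triangle`) or four lines with all degrees `2` (`KFour`) —
**`classify_six`**.  Each shape is `R₃⁺`-good at every type (`perFlat_twoLinesSix_all`, `perFlat_triangle_all`,
`perFlat_kFour_all`), so **`R3PlusPerFlatSix_holds`** (`p ≥ 8`) and, through `RLSRuleCoreSix` / `RLSRuleBigReduction`
/ `RLSRulePlus`, **`c025_three_of_seven`**: C-025 at `q = 3` for every finite matroid and every `p ≥ 5` follows from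
the `(7, 3)` core alone.
Imports `RLSRuleTriangleTypes`, `RLSRuleKFourTypes`, `RLSRuleTwoLinesSix`, `RLSRuleCoreSix`.  Axioms: standard.
-/

open scoped Matroid

namespace PercRepro

namespace NightThree

open Finset ThmH PerFlat

variable {α : Type*} [DecidableEq α] {M : Matroid α} [M.Finite]

omit [M.Finite] in
/-- Double counting: `Σ_v deg v = Σ_ℓ |G ∩ ℓ|`. -/
theorem sum_deg_eq (G : Finset α) (L : Finset (Finset α)) :
    ∑ v ∈ G, (L.filter (fun ℓ => v ∈ ℓ)).card = ∑ ℓ ∈ L, (G ∩ ℓ).card := by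
  simp_rw [← Finset.filter_mem_eq_inter, Finset.card_eq_sum_ones, Finset.sum_filter]
  exact Finset.sum_comm

/-- In a `6`-point plane of the core a point lies on at most two `3`-point lines (the lines through `v` use disjoint
pairs of the other five points). -/
theorem deg_le_two_of_lines {p : ℕ} (hc : Core M p) {G : Finset α} (hG : G ∈ flatsQ M 3) (hGc : G.card = 6)
    {L : Finset (Finset α)} (hL : ∀ ℓ ∈ L, ℓ ⊆ G ∧ ℓ.card = 3 ∧ M.eRk (ℓ : Set α) = 2) {v : α} (hv : v ∈ G) :
    (L.filter (fun ℓ => v ∈ ℓ)).card ≤ 2 := by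
  classical
  have hGE : G ⊆ gr M := (mem_flatsQ.1 hG).1
  have hsimple := simpleOn_of_core hc hGE
  have hlong := not_hasLongLine_of_core hc hGE
  have hdisj : ∀ ℓ ∈ L.filter (fun ℓ => v ∈ ℓ), ∀ ℓ' ∈ L.filter (fun ℓ => v ∈ ℓ), ℓ ≠ ℓ' →
      Disjoint (ℓ.erase v) (ℓ'.erase v) := by
    intro ℓ hℓ ℓ' hℓ' hne
    rw [Finset.disjoint_left]
    intro x hx hx'
    have hxℓ := Finset.mem_erase.1 hx
    have hxℓ' := Finset.mem_erase.1 hx'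
    have hℓL := Finset.mem_filter.1 hℓ
    have hℓ'L := Finset.mem_filter.1 hℓ'
    have hi := card_inter_le_one_of_lines hsimple hlong hGE (hL ℓ hℓL.1).1 (hL ℓ' hℓ'L.1).1 (hL ℓ hℓL.1).2.1
      (hL ℓ' hℓ'L.1).2.1 (hL ℓ hℓL.1).2.2 (hL ℓ' hℓ'L.1).2.2 hne
    have hsub : ({v, x} : Finset α) ⊆ ℓ ∩ ℓ' := by
      intro y hy
      rw [Finset.mem_insert, Finset.mem_singleton] at hy
      rcases hy with rfl | rfl
      · exact Finset.mem_inter.2 ⟨hℓL.2, hℓ'L.2⟩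
      · exact Finset.mem_inter.2 ⟨hxℓ.2, hxℓ'.2⟩
    have := Finset.card_le_card hsub
    rw [Finset.card_pair (Ne.symm hxℓ.1)] at this
    omega
  have hsub : (L.filter (fun ℓ => v ∈ ℓ)).biUnion (fun ℓ => ℓ.erase v) ⊆ G.erase v := by
    intro x hx
    rw [Finset.mem_biUnion] at hx
    obtain ⟨ℓ, hℓ, hx⟩ := hx
    rw [Finset.mem_erase] at hx ⊢
    exact ⟨hx.1, (hL ℓ (Finset.mem_filter.1 hℓ).1).1 hx.2⟩
  have h1 := Finset.card_le_card hsub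
  rw [Finset.card_biUnion hdisj, Finset.card_erase_of_mem hv, hGc] at h1
  have h2 : ∑ ℓ ∈ L.filter (fun ℓ => v ∈ ℓ), (ℓ.erase v).card = 2 * (L.filter (fun ℓ => v ∈ ℓ)).card := by
    rw [Finset.sum_congr rfl (fun ℓ hℓ => by
      rw [Finset.card_erase_of_mem (Finset.mem_filter.1 hℓ).2, (hL ℓ (Finset.mem_filter.1 hℓ).1).2.1]),
      Finset.sum_const, smul_eq_mul]
    ring
  omega

/-- The points on two lines are pairwise meeting points of lines: at most `C(|L|, 2)` of them. -/
theorem card_deg_two_le {p : ℕ} (hc : Core M p) {G : Finset α} (hG : G ∈ flatsQ M 3)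
    {L : Finset (Finset α)} (hL : ∀ ℓ ∈ L, ℓ ⊆ G ∧ ℓ.card = 3 ∧ M.eRk (ℓ : Set α) = 2) :
    (G.filter (fun v => (L.filter (fun ℓ => v ∈ ℓ)).card = 2)).card ≤ (L.powersetCard 2).card := by
  classical
  have hGE : G ⊆ gr M := (mem_flatsQ.1 hG).1
  have hsimple := simpleOn_of_core hc hGE
  have hlong := not_hasLongLine_of_core hc hGE
  apply Finset.card_le_card_of_injOn (fun v => L.filter (fun ℓ => v ∈ ℓ))
  · intro v hv
    rw [Finset.mem_coe, Finset.mem_filter] at hv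
    exact Finset.mem_coe.2 (Finset.mem_powersetCard.2 ⟨Finset.filter_subset _ _, hv.2⟩)
  · intro v hv w hw hvw
    rw [Finset.mem_coe, Finset.mem_filter] at hv hw
    have hvw' : L.filter (fun ℓ => v ∈ ℓ) = L.filter (fun ℓ => w ∈ ℓ) := hvw
    by_contra hne
    obtain ⟨ℓ, ℓ', hℓne, hpair⟩ := Finset.card_eq_two.1 hv.2
    have hℓ : ℓ ∈ L.filter (fun ℓ => v ∈ ℓ) := by rw [hpair]; exact Finset.mem_insert_self _ _
    have hℓ' : ℓ' ∈ L.filter (fun ℓ => v ∈ ℓ) := by rw [hpair]; exact Finset.mem_insert_of_mem (Finset.mem_singleton_self _)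
    have hℓw : ℓ ∈ L.filter (fun ℓ => w ∈ ℓ) := by rw [← hvw']; exact hℓ
    have hℓ'w : ℓ' ∈ L.filter (fun ℓ => w ∈ ℓ) := by rw [← hvw']; exact hℓ'
    rw [Finset.mem_filter] at hℓ hℓ' hℓw hℓ'w
    have hi := card_inter_le_one_of_lines hsimple hlong hGE (hL ℓ hℓ.1).1 (hL ℓ' hℓ'.1).1 (hL ℓ hℓ.1).2.1
      (hL ℓ' hℓ'.1).2.1 (hL ℓ hℓ.1).2.2 (hL ℓ' hℓ'.1).2.2 hℓne
    have hsub : ({v, w} : Finset α) ⊆ ℓ ∩ ℓ' := by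
      intro y hy
      rw [Finset.mem_insert, Finset.mem_singleton] at hy
      rcases hy with rfl | rfl
      · exact Finset.mem_inter.2 ⟨hℓ.2, hℓ'.2⟩
      · exact Finset.mem_inter.2 ⟨hℓw.2, hℓ'w.2⟩
    have := Finset.card_le_card hsub
    rw [Finset.card_pair hne] at this
    omega

open scoped Classical in
/-- **The `6`-point planes of the core**: two `3`-point lines, the triangle, or `K₄` (on the line set
`depTriples M G`). -/
theorem classify_six {p : ℕ} (hc : Core M p) {G : Finset α} (hG : G ∈ flatsQ M 3) (hGc : G.card = 6) :
    (∃ ℓ ℓ', TwoLinesAny M G ℓ ℓ') ∨ Triangle M G (depTriples M G) ∨ KFour M G (depTriples M G) := by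
  have hGE : G ⊆ gr M := (mem_flatsQ.1 hG).1
  have hsimple := simpleOn_of_core hc hGE
  have hL : ∀ ℓ ∈ depTriples M G, ℓ ⊆ G ∧ ℓ.card = 3 ∧ M.eRk (ℓ : Set α) = 2 := by
    intro ℓ hℓ
    unfold depTriples at hℓ
    rw [Finset.mem_filter, Finset.mem_powersetCard] at hℓ
    exact ⟨hℓ.1.1, hℓ.1.2, eRk_eq_two_of_dep_triple hsimple hℓ.1.1 hℓ.1.2 hℓ.2⟩
  have hind : ∀ T ∈ G.powersetCard 3, T ∉ depTriples M G → M.Indep (T : Set α) := by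
    intro T hT hTL
    by_contra hdep
    apply hTL
    unfold depTriples
    exact Finset.mem_filter.2 ⟨hT, hdep⟩
  have havoid : ∀ v ∈ G, ∃ ℓ ∈ depTriples M G, v ∉ ℓ := fun v hv => exists_line_avoiding_of_six hc hG hGc hv
  have hdeg : ∀ v ∈ G, ((depTriples M G).filter (fun ℓ => v ∈ ℓ)).card ≤ 2 :=
    fun v hv => deg_le_two_of_lines hc hG hGc hL hv
  have hsum : ∑ v ∈ G, ((depTriples M G).filter (fun ℓ => v ∈ ℓ)).card = 3 * (depTriples M G).card := by
    rw [sum_deg_eq, Finset.sum_congr rfl (fun ℓ hℓ => by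
      rw [Finset.inter_eq_right.2 (hL ℓ hℓ).1, (hL ℓ hℓ).2.1]), Finset.sum_const, smul_eq_mul]
    ring
  have hsum_le : ∑ v ∈ G, ((depTriples M G).filter (fun ℓ => v ∈ ℓ)).card ≤ 12 := by
    calc _ ≤ ∑ _v ∈ G, 2 := Finset.sum_le_sum hdeg
      _ = 12 := by rw [Finset.sum_const, hGc, smul_eq_mul]
  obtain ⟨v₀, hv₀⟩ : G.Nonempty := Finset.card_pos.1 (by omega)
  obtain ⟨ℓ₀, hℓ₀, _⟩ := havoid v₀ hv₀
  have hL1 : 1 ≤ (depTriples M G).card := Finset.card_pos.2 ⟨ℓ₀, hℓ₀⟩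
  rcases (show (depTriples M G).card = 1 ∨ (depTriples M G).card = 2 ∨ (depTriples M G).card = 3 ∨
      (depTriples M G).card = 4 by omega) with h1 | h2 | h3 | h4
  · -- one line: its points are avoided by no line
    exfalso
    obtain ⟨ℓ, hLℓ⟩ := Finset.card_eq_one.1 h1
    have hℓmem : ℓ ∈ depTriples M G := by rw [hLℓ]; exact Finset.mem_singleton_self ℓ
    obtain ⟨x, hx⟩ : ℓ.Nonempty := Finset.card_pos.1 (by rw [(hL ℓ hℓmem).2.1]; norm_num)
    obtain ⟨ℓ', hℓ', hxℓ'⟩ := havoid x ((hL ℓ hℓmem).1 hx)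
    rw [hLℓ, Finset.mem_singleton] at hℓ'
    exact hxℓ' (hℓ' ▸ hx)
  · left
    obtain ⟨ℓ, ℓ', hne, hLℓ⟩ := Finset.card_eq_two.1 h2
    exact ⟨ℓ, ℓ', twoLinesAny_of_depTriples_pair hsimple hne hLℓ⟩
  · right; left
    have hD := card_deg_two_le hc hG hL
    rw [Finset.card_powersetCard, h3, show Nat.choose 3 2 = 3 by norm_num [Nat.choose]] at hD
    have hsplit := Finset.sum_filter_add_sum_filter_not G (fun v => ((depTriples M G).filter (fun ℓ => v ∈ ℓ)).card = 2)
      (fun v => ((depTriples M G).filter (fun ℓ => v ∈ ℓ)).card)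
    have hcard := Finset.card_filter_add_card_filter_not (s := G)
      (fun v => ((depTriples M G).filter (fun ℓ => v ∈ ℓ)).card = 2)
    have hpart1 : ∑ v ∈ G.filter (fun v => ((depTriples M G).filter (fun ℓ => v ∈ ℓ)).card = 2),
        ((depTriples M G).filter (fun ℓ => v ∈ ℓ)).card =
        2 * (G.filter (fun v => ((depTriples M G).filter (fun ℓ => v ∈ ℓ)).card = 2)).card := by
      rw [Finset.sum_congr rfl (fun v hv => (Finset.mem_filter.1 hv).2), Finset.sum_const, smul_eq_mul]
      ring
    have hpart2 : ∑ v ∈ G.filter (fun v => ¬ ((depTriples M G).filter (fun ℓ => v ∈ ℓ)).card = 2),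
        ((depTriples M G).filter (fun ℓ => v ∈ ℓ)).card ≤
        (G.filter (fun v => ¬ ((depTriples M G).filter (fun ℓ => v ∈ ℓ)).card = 2)).card := by
      calc _ ≤ ∑ _v ∈ G.filter (fun v => ¬ ((depTriples M G).filter (fun ℓ => v ∈ ℓ)).card = 2), 1 :=
            Finset.sum_le_sum (fun v hv => by
              have := hdeg v (Finset.mem_filter.1 hv).1
              have := (Finset.mem_filter.1 hv).2
              omega)
        _ = _ := by rw [Finset.sum_const, smul_eq_mul, mul_one]
    have hD3 : (G.filter (fun v => ((depTriples M G).filter (fun ℓ => v ∈ ℓ)).card = 2)).card = 3 := by omega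
    refine ⟨hGc, h3, hL, ?_, hD3, hind⟩
    intro v hv
    by_contra hcon
    push Not at hcon
    have hv0 : ((depTriples M G).filter (fun ℓ => v ∈ ℓ)).card = 0 := by have := hdeg v hv; omega
    have hvrest : v ∈ G.filter (fun v => ¬ ((depTriples M G).filter (fun ℓ => v ∈ ℓ)).card = 2) :=
      Finset.mem_filter.2 ⟨hv, hcon.2⟩
    have hlt : ∑ v ∈ G.filter (fun v => ¬ ((depTriples M G).filter (fun ℓ => v ∈ ℓ)).card = 2),
        ((depTriples M G).filter (fun ℓ => v ∈ ℓ)).card <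
        ∑ _v ∈ G.filter (fun v => ¬ ((depTriples M G).filter (fun ℓ => v ∈ ℓ)).card = 2), 1 :=
      Finset.sum_lt_sum (fun w hw => by
          have := hdeg w (Finset.mem_filter.1 hw).1
          have := (Finset.mem_filter.1 hw).2
          omega) ⟨v, hvrest, by rw [hv0]; norm_num⟩
    rw [Finset.sum_const, smul_eq_mul, mul_one] at hlt
    omega
  · right; right
    refine ⟨hGc, h4, hL, ?_, hind⟩
    intro v hv
    by_contra hcon
    have hlt : ∑ w ∈ G, ((depTriples M G).filter (fun ℓ => w ∈ ℓ)).card < ∑ _w ∈ G, 2 :=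
      Finset.sum_lt_sum hdeg ⟨v, hv, by have := hdeg v hv; omega⟩
    rw [Finset.sum_const, hGc, smul_eq_mul] at hlt
    omega

/-- **`R₃⁺` per flat on the `6`-point planes of the core, every `p ≥ 8`.** -/
theorem R3PlusPerFlatSix_holds {p : ℕ} (hp : 8 ≤ p) : R3PlusPerFlatSix p := by
  intro β _ M _ hc G hG hGc
  obtain ⟨n, rfl⟩ : ∃ n, p = n + 4 := ⟨p - 4, by omega⟩
  rcases classify_six hc hG hGc with ⟨ℓ, ℓ', h⟩ | h | h
  · exact perFlat_twoLinesSix_all hc hG h hGc (by omega)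
  · exact perFlat_triangle_all hc hG h (by omega)
  · exact perFlat_kFour_all hc hG h (by omega)

/-- **C-025 at `q = 3` from the `(7, 3)` core alone**: for every finite matroid and every `p ≥ 5`. -/
theorem c025_three_of_seven {β : Type}
    (hseven : ∀ (M : Matroid β) [M.Finite], Core M 7 → ThmN.RLS M 7 3) :
    ∀ (M : Matroid β) [M.Finite] (p : ℕ), 5 ≤ p → ThmN.RLS M p 3 :=
  c025_three_of_big hseven (fun _ hp => R3PlusPerFlatBig_of_six (R3PlusPerFlatSix_holds hp))

end NightThree

end PercRepro
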